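import Summits.QuantumAdvantage.QuantumAdvantage.Theorems.CubicForrelationNearExactIsExactWalshTower
import Summits.QuantumAdvantage.QuantumAdvantage.Theorems.CubicForrelationNearExactIsExactAxParity

/-!
# Crux `CubicForrelation.NearExactIsExact` (stmt-QuantumAdvantage-14043) — the MIXED-DIGIT Walsh tower on 10 bits

Seat `b2b-cforr-cert` (n = 10, θ = 7/8 certificate rung).  HONEST FRAMING: a theorem about cubic Boolean functions on 10
bits — NOT summit progress.

For a CUBIC `g : 𝔽₂¹⁰ → 𝔽₂` every Walsh value is a multiple of `16` (Ax/McEliece, the landed `tw_base`): `W_g = 16·u`.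
The landed tower (`stub_walshTower`) bounds the degree of the parity `[u odd]` (`≤ 1`) and, WHEN that parity vanishes
identically, of the next parity.  This file proves the MIXED-digit refinement needed at `θ = 7/8`, where the level-4 parity
does NOT vanish (the split configuration of `split_ten`): writing the Euclidean digits `d₀ = u mod 2`, `d₁ = ⌊u/2⌋ mod 2`,
`d₂ = ⌊u/4⌋ mod 2`, the Boolean functions `d₁` and `d₂` have algebraic degree `≤ 2` and `≤ 4` respectively
(`td_digitOne`, `td_digitTwo`), with no hypothesis on `d₀`.

Proof (Poisson + Ax + Möbius, exactly as in the tower).  By Möbius inversion (`bb_moebius_isDegLeFun`) it suffices that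
`#{x ∈ E_I : d_k(x) = 1}` is even for every coordinate cube `E_I` with `|I| > 2^k`.  Poisson (`bb_poisson`) and Ax on the
complementary cube (`stub_axParity`, `d = 3`) give `16·Σ_{E_I} u = 2^{|I|}·2^{⌈(10−|I|)/3⌉}·z`, so `Σ_{E_I} u ≡ 0 (mod 4)`
for `|I| ≥ 3` and `≡ 0 (mod 8)` for `|I| ≥ 5`.  Since `u = 2⌊u/2⌋ + d₀ = 4⌊u/4⌋ + 2d₁ + d₀` pointwise, it remains to see
that `#{d₀ = 1 on E_I} ≡ 0 (mod 4)` (resp. `mod 8`) and `#{d₁ = 1 on E_I} ≡ 0 (mod 4)`: this is Ax again, for the affine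
`d₀` (`d = 1`: the bias over `E_I` is `2^{|I|}·z'`) and for the quadratic `d₁` (`d = 2`: bias `2^{⌈|I|/2⌉}·z''`).
Numerical sanity check (seat folder `work/c/digits.c`): on 3000 random cubics the three digit degrees are `≤ 1, 2, 4` and
all three bounds are attained.

References: J. Ax, Amer. J. Math. 86 (1964); R. J. McEliece, Discrete Math. 3 (1972); C. Carlet, *Boolean Functions for
Cryptography and Coding Theory*, CUP 2021, §2.2 and §4.1.  Everything below is proved from Mathlib and the tree; axioms are
the standard three.
-/

set_option linter.dupNamespace false -- D-0017: single-problem summit ⇒ `QuantumAdvantage.QuantumAdvantage` by design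

noncomputable section

namespace Summit.QuantumAdvantage.QuantumAdvantage.Theorems.CubicForrelation.NearExactIsExact

open Finset
open Literature.Computability.QuantumComplexity
open Literature.Computability.QuantumComplexity.DerivativeWalsh (W)

/-! ### Counting on cubes: Ax's theorem for the digit functions themselves -/

/-- The number of `1`s of a Boolean function `P` of degree `≤ d` (`d ≥ 1`) on the coordinate cube `E_I` satisfies
`2·#{x ∈ E_I : P x} = 2^{|I|} − 2^{⌈|I|/d⌉}·z` for some integer `z` (Ax's theorem on the cube, `stub_axParity`, read through
`Σ (−1)^P = |E_I| − 2·#{P = 1}`). [cite: Carlet2020, §4.1] -/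
theorem td_count_cube {n d : ℕ} (hd : 1 ≤ d) (P : (Fin n → Bool) → Bool) (hP : IsDegLeFun d P) (I : Finset (Fin n)) :
    ∃ z : ℤ, (2 * #{x : Fin n → Bool | (∀ i, x i = true → i ∈ I) ∧ P x = true} : ℤ) =
      2 ^ #I - 2 ^ ((#I + d - 1) / d) * z := by
  obtain ⟨z, hz⟩ := stub_axParity n d P I hd hP
  refine ⟨z, ?_⟩
  have hs := bb_sum_signOf (fun x : Fin n → Bool => ∀ i, x i = true → i ∈ I) P
  rw [bb_card_cube] at hs
  rw [hs] at hz
  have h' : ((2 * #{x : Fin n → Bool | (∀ i, x i = true → i ∈ I) ∧ P x = true} : ℤ) : ℝ) =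
      ((2 ^ #I - 2 ^ ((#I + d - 1) / d) * z : ℤ) : ℝ) := by
    push_cast at hz ⊢
    linarith
  exact_mod_cast h'

/-- The cube sums of `u = W_g/16` for a cubic `g` on 10 bits: `16·Σ_{E_I} u = 2^{|I|}·2^{⌈(10−|I|)/3⌉}·z` (Poisson over
`E_I`, Ax on `E_{Iᶜ}`). [cite: Carlet2020, §4.1] -/
theorem td_cube_sum (g : (Fin (5 + 5) → Bool) → Bool) (u : (Fin (5 + 5) → Bool) → ℤ) (hg : IsDegLeFun 3 g)
    (hu : ∀ x, W (fun y => signOf (g y)) x = (2 : ℝ) ^ 4 * (u x : ℝ)) (I : Finset (Fin (5 + 5))) :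
    ∃ z : ℤ, (2 : ℤ) ^ 4 * ∑ x ∈ {x : Fin (5 + 5) → Bool | ∀ i, x i = true → i ∈ I}, u x =
      2 ^ #I * (2 ^ ((5 + 5 - #I + 2) / 3) * z) := by
  have hP := bb_poisson (fun y => signOf (g y)) I
  obtain ⟨z, hz⟩ := stub_axParity (5 + 5) 3 g Iᶜ (by norm_num) hg
  have hj : #Iᶜ = 5 + 5 - #I := by rw [card_compl, Fintype.card_fin]
  rw [hj, show (5 + 5 - #I + 3 - 1) / 3 = (5 + 5 - #I + 2) / 3 by omega] at hz
  rw [sum_congr rfl fun x _ => hu x, ← mul_sum, hz] at hP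
  refine ⟨z, ?_⟩
  have h' : (((2 : ℤ) ^ 4 * ∑ x ∈ {x : Fin (5 + 5) → Bool | ∀ i, x i = true → i ∈ I}, u x : ℤ) : ℝ) =
      (((2 : ℤ) ^ #I * (2 ^ ((5 + 5 - #I + 2) / 3) * z) : ℤ) : ℝ) := by
    push_cast at hP ⊢
    linarith
  exact_mod_cast h'

/-- Divisibility read-out: if `2^4·S = 2^i·(2^c·z)` and `4 + e ≤ i + c` then `2^e ∣ S`. [folklore] -/
theorem td_dvd_of_balance {i c e : ℕ} {S z : ℤ} (hle : 4 + e ≤ i + c)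
    (h : (2 : ℤ) ^ 4 * S = 2 ^ i * (2 ^ c * z)) : (2 : ℤ) ^ e ∣ S := by
  obtain ⟨r, hr⟩ : ∃ r, i + c = 4 + e + r := ⟨i + c - (4 + e), by omega⟩
  refine ⟨2 ^ r * z, ?_⟩
  have h0 : (2 : ℤ) ^ 4 ≠ 0 := by positivity
  apply mul_left_cancel₀ h0
  rw [h, ← mul_assoc, ← pow_add, hr, pow_add, pow_add]
  ring

/-- Pointwise Euclidean digit expansion used below: `u = 2·⌊u/2⌋ + (u mod 2)` with `u mod 2 = [u odd]`. [folklore] -/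
theorem td_two_mul_div_add (a : ℤ) : a = 2 * (a / 2) + (if Odd a then 1 else 0) := by
  rcases Int.emod_two_eq_zero_or_one a with h | h
  · rw [if_neg (Int.not_odd_iff_even.2 (Int.even_iff.2 h))]
    omega
  · rw [if_pos (Int.odd_iff.2 h)]
    omega

/-- The sum of `[u odd]` over a finset is the number of odd values. [folklore] -/
theorem td_sum_ite_odd {α : Type*} (s : Finset α) (v : α → ℤ) :
    ∑ x ∈ s, (if Odd (v x) then (1 : ℤ) else 0) = #(s.filter fun x => Odd (v x)) := by
  rw [sum_boole]

/-! ### The two mixed digits -/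

/-- **Digit one.** For cubic `g` on 10 bits with `W_g = 16·u`, the Boolean function `x ↦ [⌊u(x)/2⌋ odd]` (the second
Euclidean binary digit of `u`, with NO assumption on the first) has algebraic degree `≤ 2`. [this work; cite: Carlet2020,
§4.1 (McEliece) for the divisibility input] -/
theorem td_digitOne (g : (Fin (5 + 5) → Bool) → Bool) (u : (Fin (5 + 5) → Bool) → ℤ) (hg : IsDegLeFun 3 g)
    (hu : ∀ x, W (fun y => signOf (g y)) x = (2 : ℝ) ^ 4 * (u x : ℝ)) :
    IsDegLeFun 2 (fun x => decide (Odd (u x / 2))) := by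
  have hP0 : IsDegLeFun 1 (fun x => decide (Odd (u x))) :=
    stub_walshTower stub_axParity (5 + 5) 4 1 g u hg hu (by intro k hk hkn; omega)
  refine bb_moebius_isDegLeFun 2 _ fun I hI => ?_
  have hk : #I ≤ 5 + 5 := (card_le_univ I).trans_eq (Fintype.card_fin _)
  -- the cube sum of `u` is divisible by 4
  obtain ⟨z, hz⟩ := td_cube_sum g u hg hu I
  have h4 : (2 : ℤ) ^ 2 ∣ ∑ x ∈ {x : Fin (5 + 5) → Bool | ∀ i, x i = true → i ∈ I}, u x :=
    td_dvd_of_balance (by omega) hz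
  -- the number of odd `u` on the cube is divisible by 4
  obtain ⟨z', hz'⟩ := td_count_cube (le_refl 1) (fun x => decide (Odd (u x))) hP0 I
  rw [show (#I + 1 - 1) / 1 = #I by simp] at hz'
  have hA : (4 : ℤ) ∣ #{x : Fin (5 + 5) → Bool | (∀ i, x i = true → i ∈ I) ∧ decide (Odd (u x)) = true} := by
    obtain ⟨e, he⟩ : ∃ e, #I = e + 3 := ⟨#I - 3, by omega⟩
    rw [he, show (2 : ℤ) ^ (e + 3) = 2 ^ e * 8 by rw [pow_add]; norm_num] at hz'
    refine ⟨2 ^ e * (1 - z'), ?_⟩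
    linarith
  -- split `u = 2⌊u/2⌋ + [u odd]` under the sum
  have hsplit : ∑ x ∈ {x : Fin (5 + 5) → Bool | ∀ i, x i = true → i ∈ I}, u x =
      2 * ∑ x ∈ {x : Fin (5 + 5) → Bool | ∀ i, x i = true → i ∈ I}, u x / 2 +
        #{x : Fin (5 + 5) → Bool | (∀ i, x i = true → i ∈ I) ∧ decide (Odd (u x)) = true} := by
    rw [sum_congr rfl fun x _ => td_two_mul_div_add (u x), sum_add_distrib, ← mul_sum, td_sum_ite_odd, filter_filter]
    simp only [decide_eq_true_eq]
  have hE : Even (∑ x ∈ {x : Fin (5 + 5) → Bool | ∀ i, x i = true → i ∈ I}, u x / 2) := by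
    rw [pow_two] at h4
    obtain ⟨q, hq⟩ := h4
    obtain ⟨a, ha⟩ := hA
    refine ⟨q - a, ?_⟩
    linarith
  have hE' := (tw_even_sum_iff _ (fun x => u x / 2)).1 hE
  rw [filter_filter] at hE'
  simpa only [decide_eq_true_eq] using hE'

/-- **Digit two.** For cubic `g` on 10 bits with `W_g = 16·u`, the Boolean function `x ↦ [⌊⌊u(x)/2⌋/2⌋ odd]` (the third
Euclidean binary digit of `u`) has algebraic degree `≤ 4`. [this work; cite: Carlet2020, §4.1 (McEliece) for the
divisibility input] -/
theorem td_digitTwo (g : (Fin (5 + 5) → Bool) → Bool) (u : (Fin (5 + 5) → Bool) → ℤ) (hg : IsDegLeFun 3 g)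
    (hu : ∀ x, W (fun y => signOf (g y)) x = (2 : ℝ) ^ 4 * (u x : ℝ)) :
    IsDegLeFun 4 (fun x => decide (Odd (u x / 2 / 2))) := by
  have hP0 : IsDegLeFun 1 (fun x => decide (Odd (u x))) :=
    stub_walshTower stub_axParity (5 + 5) 4 1 g u hg hu (by intro k hk hkn; omega)
  have hP1 := td_digitOne g u hg hu
  refine bb_moebius_isDegLeFun 4 _ fun I hI => ?_
  have hk : #I ≤ 5 + 5 := (card_le_univ I).trans_eq (Fintype.card_fin _)
  obtain ⟨z, hz⟩ := td_cube_sum g u hg hu I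
  have h8 : (2 : ℤ) ^ 3 ∣ ∑ x ∈ {x : Fin (5 + 5) → Bool | ∀ i, x i = true → i ∈ I}, u x :=
    td_dvd_of_balance (by omega) hz
  -- `#{u odd on E_I} ≡ 0 (mod 8)`
  obtain ⟨z', hz'⟩ := td_count_cube (le_refl 1) (fun x => decide (Odd (u x))) hP0 I
  rw [show (#I + 1 - 1) / 1 = #I by simp] at hz'
  have hA : (8 : ℤ) ∣ #{x : Fin (5 + 5) → Bool | (∀ i, x i = true → i ∈ I) ∧ decide (Odd (u x)) = true} := by
    obtain ⟨e, he⟩ : ∃ e, #I = e + 4 := ⟨#I - 4, by omega⟩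
    rw [he, show (2 : ℤ) ^ (e + 4) = 2 ^ e * 16 by rw [pow_add]; norm_num] at hz'
    refine ⟨2 ^ e * (1 - z'), ?_⟩
    linarith
  -- `#{⌊u/2⌋ odd on E_I} ≡ 0 (mod 4)`
  obtain ⟨z'', hz''⟩ := td_count_cube (by norm_num : 1 ≤ 2) (fun x => decide (Odd (u x / 2))) hP1 I
  have hB : (4 : ℤ) ∣ #{x : Fin (5 + 5) → Bool | (∀ i, x i = true → i ∈ I) ∧ decide (Odd (u x / 2)) = true} := by
    obtain ⟨e, he⟩ : ∃ e, #I = e + 5 := ⟨#I - 5, by omega⟩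
    obtain ⟨e', he'⟩ : ∃ e', (#I + 2 - 1) / 2 = e' + 3 := ⟨(#I + 2 - 1) / 2 - 3, by omega⟩
    rw [he', he, show (2 : ℤ) ^ (e + 5) = 2 ^ e * 32 by rw [pow_add]; norm_num,
      show (2 : ℤ) ^ (e' + 3) = 2 ^ e' * 8 by rw [pow_add]; norm_num] at hz''
    refine ⟨2 ^ e * 4 - 2 ^ e' * z'', ?_⟩
    linarith
  have hsplit : ∑ x ∈ {x : Fin (5 + 5) → Bool | ∀ i, x i = true → i ∈ I}, u x =
      2 * (2 * ∑ x ∈ {x : Fin (5 + 5) → Bool | ∀ i, x i = true → i ∈ I}, u x / 2 / 2 +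
        #{x : Fin (5 + 5) → Bool | (∀ i, x i = true → i ∈ I) ∧ decide (Odd (u x / 2)) = true}) +
        #{x : Fin (5 + 5) → Bool | (∀ i, x i = true → i ∈ I) ∧ decide (Odd (u x)) = true} := by
    rw [sum_congr rfl fun x _ => td_two_mul_div_add (u x), sum_add_distrib, ← mul_sum, td_sum_ite_odd, filter_filter,
      sum_congr rfl fun x _ => td_two_mul_div_add (u x / 2), sum_add_distrib, ← mul_sum, td_sum_ite_odd, filter_filter]
    simp only [decide_eq_true_eq]
  have hE : Even (∑ x ∈ {x : Fin (5 + 5) → Bool | ∀ i, x i = true → i ∈ I}, u x / 2 / 2) := by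
    obtain ⟨q, hq⟩ := h8
    obtain ⟨a, ha⟩ := hA
    obtain ⟨b, hb⟩ := hB
    refine ⟨q - a - b, ?_⟩
    have := hsplit
    rw [hq, ha, hb] at this
    linarith
  have hE' := (tw_even_sum_iff _ (fun x => u x / 2 / 2)).1 hE
  rw [filter_filter] at hE'
  simpa only [decide_eq_true_eq] using hE'

/-- The three Euclidean digits reassemble `u` modulo `8`:
`u ≡ [u odd] + 2·[⌊u/2⌋ odd] + 4·[⌊⌊u/2⌋/2⌋ odd] (mod 8)`. [folklore] -/
theorem td_mod_eight (a : ℤ) : ∃ q : ℤ, a = 8 * q + ((if Odd a then 1 else 0) + 2 * (if Odd (a / 2) then 1 else 0) +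
    4 * (if Odd (a / 2 / 2) then 1 else 0)) := by
  refine ⟨a / 2 / 2 / 2, ?_⟩
  have h0 := td_two_mul_div_add a
  have h1 := td_two_mul_div_add (a / 2)
  have h2 := td_two_mul_div_add (a / 2 / 2)
  omega

end Summit.QuantumAdvantage.QuantumAdvantage.Theorems.CubicForrelation.NearExactIsExact

end
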